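import Summits.RiemannHypothesis.RiemannHypothesis.Theorems.IntegerScrewScrewPolyFloorLandauBlockSharp
import Summits.RiemannHypothesis.RiemannHypothesis.Theorems.IntegerScrewScrewPolyFloorLandauWindow
import HarnessLib

/-!
# Route IntegerScrew — RH-free positivity of the Landau pairing over a window, loss `O(M^{5/2})`

Helper file for crux `IntegerScrew.ScrewPolyFloor` (stmt-RiemannHypothesis-15757): the sharp form
of `pairing_window_positive` — `pairing_window_lower_bound_sharp` combined with the Riemann–von
Mangoldt window count `zetaZeroCount_window_lower`:

  `Re(D(T₂) − D(T₁)) ≥ [((T₂−T₁)/π)(log(T₁/2π) − log M − 1) − C(log T₂ + M²√M(log²T₂ + log 3M))] ∑ y_m²`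

for `T* ≤ T₁ ≤ T₂` (`pairing_window_positive_sharp`). The window of high zeros is an RH-free
positive reservoir as soon as `log T₁ ≫ log M` and `T₂ − T₁ ≫ M^{5/2} log²T₂ / log T₁`.
-/

noncomputable section

open Complex Finset
open scoped Real

-- the layout-mandated namespace repeats the summit name
set_option linter.dupNamespace false

namespace Summit.RiemannHypothesis.RiemannHypothesis.Theorems.IntegerScrewLandau

open Literature.NumberTheory.LFunctions

/-- **RH-free positivity of the Landau pairing over a window of high zeros, sharp form.** There are
absolute `C > 0` and `T* ≥ 2` such that for all `M ≥ 1`, all real `y`, and all `T* ≤ T₁ ≤ T₂`,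
`Re(D(T₂) − D(T₁)) ≥ [((T₂−T₁)/π)(log(T₁/2π) − log M − 1) − C (log T₂ + M²√M(log²T₂ + log 3M))] ∑_{m ≤ M} y_m²`,
`D(T) = ∑_{|Im ρ| ≤ T} m(ρ) P_y(ρ−½)P_y(−(ρ−½))`, `P_y(s) = ∑_{m ≤ M} y_m m^s`
(`pairing_window_lower_bound_sharp` + `zetaZeroCount_window_lower`). [folklore] -/
theorem pairing_window_positive_sharp :
    ∃ C T₀ : ℝ, 0 < C ∧ 2 ≤ T₀ ∧ ∀ (M : ℕ), 1 ≤ M → ∀ (y : ℕ → ℝ) (T₁ T₂ : ℝ), T₀ ≤ T₁ → T₁ ≤ T₂ →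
      ((T₂ - T₁) / π * (Real.log (T₁ / (2 * π)) - Real.log M - 1) -
          C * (Real.log T₂ + (M : ℝ) ^ 2 * Real.sqrt M * (Real.log T₂ ^ 2 + Real.log (3 * M)))) *
          ∑ m ∈ Icc 1 M, y m ^ 2 ≤
      ((∑ ρ ∈ (weilZeroIndex_finite T₂).toFinset, (riemannZetaZeroOrder ρ : ℂ) *
          ((∑ m ∈ Icc 1 M, (y m : ℂ) * (m : ℂ) ^ (ρ - 1 / 2)) *
            (∑ m ∈ Icc 1 M, (y m : ℂ) * (m : ℂ) ^ (-(ρ - 1 / 2))))) -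
        ∑ ρ ∈ (weilZeroIndex_finite T₁).toFinset, (riemannZetaZeroOrder ρ : ℂ) *
          ((∑ m ∈ Icc 1 M, (y m : ℂ) * (m : ℂ) ^ (ρ - 1 / 2)) *
            (∑ m ∈ Icc 1 M, (y m : ℂ) * (m : ℂ) ^ (-(ρ - 1 / 2))))).re := by
  obtain ⟨CB, hCB0, hB⟩ := pairing_window_lower_bound_sharp
  obtain ⟨CN, T₀, hCN0, hT₀2, hN⟩ := zetaZeroCount_window_lower
  refine ⟨max CB (2 * CN), T₀, lt_max_of_lt_left hCB0, hT₀2, fun M hM y T₁ T₂ h1 h12 ↦ ?_⟩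
  have hT₁2 : 2 ≤ T₁ := hT₀2.trans h1
  have hT₁0 : 0 ≤ T₁ := by linarith
  have hT₂0 : 0 ≤ T₂ := by linarith
  have h := hB M hM y T₁ T₂ hT₁2 h12
  have hn := hN T₁ T₂ h1 h12
  rw [sum_order_eq_two_mul_zetaZeroCount hT₂0, sum_order_eq_two_mul_zetaZeroCount hT₁0] at h
  set S : ℝ := ∑ m ∈ Icc 1 M, y m ^ 2 with hS
  have hS0 : 0 ≤ S := Finset.sum_nonneg fun _ _ ↦ sq_nonneg _
  have hlog2 : 0 ≤ Real.log T₂ := Real.log_nonneg (by linarith)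
  have hM1 : (1 : ℝ) ≤ M := by exact_mod_cast hM
  have hlam : 0 ≤ Real.log (3 * M) := Real.log_nonneg (by linarith)
  have hE0 : 0 ≤ (M : ℝ) ^ 2 * Real.sqrt M * (Real.log T₂ ^ 2 + Real.log (3 * M)) := by positivity
  -- the count
  have hcount : (T₂ - T₁) / π * Real.log (T₁ / (2 * π)) - 2 * CN * Real.log T₂ ≤
      2 * zetaZeroCount T₂ - 2 * zetaZeroCount T₁ := by
    have e : (T₂ - T₁) / π * Real.log (T₁ / (2 * π)) = 2 * ((T₂ - T₁) / (2 * π) * Real.log (T₁ / (2 * π))) := by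
      field_simp
    rw [e]
    linarith
  -- constants
  have hc1 : CB ≤ max CB (2 * CN) := le_max_left _ _
  have hc2 : 2 * CN ≤ max CB (2 * CN) := le_max_right _ _
  have h0 : 0 ≤ max CB (2 * CN) := le_trans hCB0.le hc1
  -- assemble
  have step : ((T₂ - T₁) / π * (Real.log (T₁ / (2 * π)) - Real.log M - 1) -
      max CB (2 * CN) * (Real.log T₂ + (M : ℝ) ^ 2 * Real.sqrt M * (Real.log T₂ ^ 2 + Real.log (3 * M)))) * S ≤
      (2 * zetaZeroCount T₂ - 2 * zetaZeroCount T₁) * S -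
        (T₂ - T₁) / π * (Real.log M + 1) * S -
        CB * (M : ℝ) ^ 2 * Real.sqrt M * (Real.log T₂ ^ 2 + Real.log (3 * M)) * S := by
    have p1 : ((T₂ - T₁) / π * Real.log (T₁ / (2 * π)) - 2 * CN * Real.log T₂) * S ≤
        (2 * zetaZeroCount T₂ - 2 * zetaZeroCount T₁) * S :=
      mul_le_mul_of_nonneg_right hcount hS0
    have p2 : CB * ((M : ℝ) ^ 2 * Real.sqrt M * (Real.log T₂ ^ 2 + Real.log (3 * M))) * S ≤
        max CB (2 * CN) * ((M : ℝ) ^ 2 * Real.sqrt M * (Real.log T₂ ^ 2 + Real.log (3 * M))) * S :=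
      mul_le_mul_of_nonneg_right (mul_le_mul_of_nonneg_right hc1 hE0) hS0
    have p3 : 2 * CN * Real.log T₂ * S ≤ max CB (2 * CN) * Real.log T₂ * S :=
      mul_le_mul_of_nonneg_right (mul_le_mul_of_nonneg_right hc2 hlog2) hS0
    nlinarith [p1, p2, p3]
  exact step.trans h

end Summit.RiemannHypothesis.RiemannHypothesis.Theorems.IntegerScrewLandau

end
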